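import Summits.ResolutionOfSingularities.ResolutionOfSingularities.Theorems.FrobeniusClosingSteerLowTamingStep
import Summits.ResolutionOfSingularities.ResolutionOfSingularities.Theorems.FrobeniusClosingSteerCriticalSurface
import Summits.ResolutionOfSingularities.ResolutionOfSingularities.Theorems.FrobeniusClosingSteerNormalStart
import Summits.ResolutionOfSingularities.ResolutionOfSingularities.Theorems.FrobeniusClosingSteerLowTowerSingular
import Summits.ResolutionOfSingularities.ResolutionOfSingularities.Theorems.FrobeniusClosingSteerDivisorTriggerTwoChart
import Summits.ResolutionOfSingularities.ResolutionOfSingularities.Theorems.FrobeniusClosingSteerRadicandNormalNoSingularCurve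
import Literature.AlgebraicGeometry.Resolution.ExcellentRingsEssFiniteType
import Literature.AlgebraicGeometry.Resolution.ExcellentRingsFieldProofs
import Literature.AlgebraicGeometry.Resolution.ExcellentRingsProofs
import Literature.AlgebraicGeometry.Resolution.FiniteNormalizationGRing
import Literature.AlgebraicGeometry.Resolution.RegularLocalRingsUFD
import Literature.AlgebraicGeometry.Resolution.CompleteLocalDomainNormalization
import Mathlib.RingTheory.Polynomial.Subring
import Mathlib.RingTheory.Ideal.UFD
import Mathlib.Data.Set.Card
import HarnessLib

/-!
# Taming of the LOW tower — preparations (D3c `LowTowerTamingTwo`, W4.1)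

W4.1, crux `Steer` (stmt-ResolutionOfSingularities-16345), σ-line at `p = 2`, LOW half, piece D3c (res-L0-w41-strat-2 §σ2.24
`LowTowerTamingTwo`, plan-1 RULING 41). Theses-free, def-free preparations for the assembly `FrobeniusClosingSteerLowTaming.lean`:

* `mem_of_monic_relation` — the skeleton's `IsIntegralOver` relation over an integrally closed subring with fraction field `L` forces
  membership (`IsNormalIn` unfolded);
* `isIntegrallyClosed_closure_insert` — the torsor ring `A[T]` (`T² = h`, `h` not a square of a fraction, no singular curve) is integrally
  closed (`RadicandNormal` p518080 + `DivisorTrigger.isRegularLocalRing_adjoinRoot_bot` + `LowTower.nonempty_ringEquiv_closure_insert_adjoinRoot`);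
* `finite_setOf_singular` — singular primes (neither `⊥` nor `𝔪`) are finite once a derivation moves the radicand
  (`CriticalSurface.derivation_apply_mem_of_singular` + `BadCurveLineage.finite_setOf_isPrime_height_one_mem`);
* `ringKrullDim_quotient_eq_one`, `module_finite_integralClosure_quotient` — the quotient of a surface germ by a curve is an excellent curve
  germ (Auslander–Buchsbaum UFD + excellence of essentially-finite-type algebras over a field + G-ring ⇒ finite normalisation).

No Theses file of W4.1 is imported; nothing here is a route item. OURS (the W4.1 engine), standard commutative algebra; NOT a statement
of the manuscript under review [claim: Hironaka2017, status: under-review]. [cite: StacksProject, Tag 031S] [cite: Matsumura1987, Thm. 14.2, Thm. 20.3]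
[cite: Kollar2007, Thm. 1.101]
-/

noncomputable section

-- `Summit.<S>.<S>.…` duplicates the summit name by design (single-problem summit).
set_option linter.dupNamespace false

open Polynomial IsLocalRing Literature.AlgebraicGeometry.Resolution

namespace Summit.ResolutionOfSingularities.ResolutionOfSingularities.Theorems.SwitchingDichotomy.LowTaming

variable {L : Type} [Field L]

/-! ## §1 Normality bookkeeping -/

/-- An element of the fraction field integral over an integrally closed subring (monic relation with coefficients in the
subring, the skeleton's `IsIntegralOver`) lies in the subring. [folklore] -/
theorem mem_of_monic_relation (Y : Subring L) [IsIntegrallyClosed Y] [IsFractionRing Y L] (z : L)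
    (hz : ∃ q : L[X], q.Monic ∧ (∀ i, q.coeff i ∈ Y) ∧ q.eval z = 0) : z ∈ Y := by
  obtain ⟨q, hqm, hqc, hqz⟩ := hz
  have hp : (↑q.coeffs : Set L) ⊆ Y := by
    intro c hc
    obtain ⟨i, -, rfl⟩ := Polynomial.mem_coeffs_iff.mp (Finset.mem_coe.mp hc)
    exact hqc i
  have hint : IsIntegral Y z := by
    refine ⟨q.toSubring Y hp, (Polynomial.monic_toSubring q Y hp).mpr hqm, ?_⟩
    rw [Polynomial.eval₂_eq_eval_map]
    have : (q.toSubring Y hp).map (algebraMap Y L) = q := Polynomial.map_toSubring q Y hp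
    rw [this]
    exact hqz
  obtain ⟨y, hy⟩ := IsIntegrallyClosed.isIntegral_iff.mp hint
  rw [← hy]
  exact y.2

/-- **The torsor ring over a surface germ with no singular curve is integrally closed**: `A ⊆ L` a regular local subring of
dimension two and characteristic `2`, `T² = h ∈ A`, `h` not the square of a fraction of `A`, and every height-one prime non-singular for
the radicand ⇒ `A[T] = closure (A ∪ {T})` is integrally closed. [cite: StacksProject, Tag 031S] [cite: Matsumura1987, Thm. 19.4] -/
theorem isIntegrallyClosed_closure_insert [CharP L 2] (A : Subring L) [IsRegularLocalRing A]
    (hdim : ringKrullDim A = (2 : ℕ)) {T h : L} (hh : h ∈ A) (hT : T ^ 2 = h)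
    (hnr : ∀ u v : A, (v : L) ≠ 0 → ((u : L) / (v : L)) ^ 2 ≠ h)
    (hcurves : ∀ (𝔮 : Ideal A) [𝔮.IsPrime], 𝔮.height = 1 →
      IsRegularLocalRing (AdjoinRoot ((X : (Localization.AtPrime 𝔮)[X]) ^ 2 -
        C (algebraMap A (Localization.AtPrime 𝔮) ⟨h, hh⟩)))) :
    IsIntegrallyClosed (Subring.closure (insert T (A : Set L))) := by
  haveI : Fact (Nat.Prime 2) := ⟨Nat.prime_two⟩
  have hirr : ∀ y z : A, (z : L) ≠ 0 → T * z ≠ y := by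
    intro y z hz hyz
    apply hnr y z hz
    rw [← hT, ← hyz, mul_div_cancel_right₀ _ hz]
  have hbot := DivisorTrigger.isRegularLocalRing_adjoinRoot_bot 2 A ⟨h, hh⟩ T (by rw [hT]) hirr
  haveI : IsDomain A := inferInstance
  have hns : ∀ (𝔮 : Ideal A) [𝔮.IsPrime], 𝔮 ≠ maximalIdeal A →
      IsRegularLocalRing (AdjoinRoot ((X : (Localization.AtPrime 𝔮)[X]) ^ 2 -
        C (algebraMap A (Localization.AtPrime 𝔮) ⟨h, hh⟩))) := by
    intro 𝔮 _ hm
    by_cases h0 : 𝔮 = ⊥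
    · subst h0
      convert hbot
    · exact hcurves 𝔮 (RadicandNormal.height_eq_one_of_ne_bot_of_ne_maximalIdeal hdim 𝔮 h0 hm)
  haveI hIC := RadicandNormal.isIntegrallyClosed_adjoinRoot_of_forall_ne_maximalIdeal (S := A) 2 ⟨h, hh⟩ hdim hns
  obtain ⟨e⟩ := LowTower.nonempty_ringEquiv_closure_insert_adjoinRoot A hh hT hnr
  exact IsIntegrallyClosed.of_equiv e.symm

/-! ## §2 Bad curves: finiteness, dimension and normalisation of the quotient -/

/-- In a regular local subring of dimension two with a derivation `D` and `D f ≠ 0`, the primes (neither `⊥` nor `𝔪`) at which the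
torsor `T² = f` is singular are FINITE in number: they have height one and contain `D f`. [cite: Matsumura1987, Thm. 14.2] -/
theorem finite_setOf_singular [CharP L 2] (S : Subring L) [IsRegularLocalRing S] (hdim : ringKrullDim S = (2 : ℕ))
    (f : S) (D : Derivation ℤ S S) (hD : D f ≠ 0) :
    {𝔮 : Ideal S | ∃ _ : 𝔮.IsPrime, 𝔮 ≠ ⊥ ∧ 𝔮 ≠ maximalIdeal S ∧
      ¬ IsRegularLocalRing (AdjoinRoot ((X : (Localization.AtPrime 𝔮)[X]) ^ 2 -
        C (algebraMap S (Localization.AtPrime 𝔮) f)))}.Finite := by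
  haveI := isDomain_of_isRegularLocalRing S
  refine (BadCurveLineage.finite_setOf_isPrime_height_one_mem (A := S) hD).subset ?_
  rintro 𝔮 ⟨h𝔮, h0, hm, hsing⟩
  exact ⟨h𝔮, RadicandNormal.height_eq_one_of_ne_bot_of_ne_maximalIdeal hdim 𝔮 h0 hm,
    CriticalSurface.derivation_apply_mem_of_singular S f 𝔮 hsing D⟩

/-- In a regular local ring of dimension two, the quotient by a prime neither `⊥` nor `𝔪` has Krull dimension one (the prime is
principal, generated by a prime element: Auslander–Buchsbaum). [cite: Matsumura1987, Thm. 20.3] -/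
theorem ringKrullDim_quotient_eq_one {S : Type} [CommRing S] [IsRegularLocalRing S] (hdim : ringKrullDim S = (2 : ℕ))
    (𝔮 : Ideal S) [𝔮.IsPrime] (h0 : 𝔮 ≠ ⊥) (hm : 𝔮 ≠ maximalIdeal S) : ringKrullDim (S ⧸ 𝔮) = 1 := by
  haveI := isDomain_of_isRegularLocalRing S
  haveI := IsRegularLocalRing.uniqueFactorizationMonoid S
  have h1 : 𝔮.height = 1 := RadicandNormal.height_eq_one_of_ne_bot_of_ne_maximalIdeal hdim 𝔮 h0 hm
  obtain ⟨x, hx𝔮, hx⟩ := Ideal.IsPrime.exists_mem_prime_of_ne_bot ‹_› h0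
  have heq : 𝔮 = Ideal.span {x} := Ideal.eq_span_singleton_of_height_eq_one h1 hx𝔮 hx
  have hxm : x ∈ maximalIdeal S := IsLocalRing.le_maximalIdeal (Ideal.IsPrime.ne_top ‹_›) hx𝔮
  have hm2 : (maximalIdeal S).height = ringKrullDim S := IsLocalRing.maximalIdeal_height_eq_ringKrullDim
  have hd := Module.ringKrullDim_quotient_add_one_of_mem_nonZeroDivisors (mem_nonZeroDivisors_of_ne_zero hx.ne_zero) hm2 hxm
  rw [← heq, hdim] at hd
  -- `dim (S ⧸ 𝔮) + 1 = 2`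
  haveI : Nontrivial (S ⧸ 𝔮) := Ideal.Quotient.nontrivial_iff.mpr (Ideal.IsPrime.ne_top ‹_›)
  haveI : IsLocalRing (S ⧸ 𝔮) := IsLocalRing.of_surjective' (Ideal.Quotient.mk 𝔮) Ideal.Quotient.mk_surjective
  obtain ⟨n, hn⟩ := exists_nat_cast_eq_ringKrullDim (R := S ⧸ 𝔮)
  rw [hn] at hd ⊢
  have h' : ((n + 1 : ℕ) : WithBot ℕ∞) = ((2 : ℕ) : WithBot ℕ∞) := by push_cast; exact hd
  have hn1 : n = 1 := by have := Nat.cast_injective (R := WithBot ℕ∞) h'; omega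
  rw [hn1, Nat.cast_one]

/-- **The quotient of a surface germ of the LOW tower by a curve is an excellent curve germ**: for `A` a `k`-subalgebra of `L`,
essentially of finite type over the field `k`, whose underlying subring is a regular local ring of dimension two, and a prime `𝔮`
neither `⊥` nor `𝔪`, the quotient `A ⧸ 𝔮` (a one-dimensional Noetherian local domain) has module-finite normalisation (excellence of
essentially-finite-type algebras over a field, G-ring ⇒ finite normalisation). [cite: Matsumura1987, §32] [cite: Kollar2007, Thm. 1.101] -/
theorem module_finite_integralClosure_quotient {k : Type} [Field k] [Algebra k L] (A : Subalgebra k L)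
    [hreg : IsRegularLocalRing A.toSubring] (hdim : ringKrullDim A.toSubring = (2 : ℕ)) (hft : Algebra.EssFiniteType k A)
    (𝔮 : Ideal A.toSubring) [𝔮.IsPrime] (h0 : 𝔮 ≠ ⊥) (hm : 𝔮 ≠ maximalIdeal A.toSubring) :
    haveI : IsDomain (A.toSubring ⧸ 𝔮) := (Ideal.Quotient.isDomain_iff_prime _).mpr inferInstance
    Module.Finite (A.toSubring ⧸ 𝔮) (integralClosure (A.toSubring ⧸ 𝔮) (FractionRing (A.toSubring ⧸ 𝔮))) := by
  haveI : IsDomain (A.toSubring ⧸ 𝔮) := (Ideal.Quotient.isDomain_iff_prime _).mpr inferInstance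
  haveI : Nontrivial (A.toSubring ⧸ 𝔮) := Ideal.Quotient.nontrivial_iff.mpr (Ideal.IsPrime.ne_top ‹_›)
  haveI : IsLocalRing (A.toSubring ⧸ 𝔮) :=
    IsLocalRing.of_surjective' (Ideal.Quotient.mk 𝔮) Ideal.Quotient.mk_surjective
  have hE : IsExcellentRing A.toSubring :=
    IsExcellentRing.of_essFiniteType (isExcellentRing_of_field k) (B := A) hft
  have hG : IsGRing (A.toSubring ⧸ 𝔮) :=
    isGRing_of_surjective (Ideal.Quotient.mk 𝔮) Ideal.Quotient.mk_surjective hE.isQuasiExcellentRing.isGRing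
  exact module_finite_integralClosure_of_isGRing_of_ringKrullDim_eq_one _ hG
    (ringKrullDim_quotient_eq_one hdim 𝔮 h0 hm)

end Summit.ResolutionOfSingularities.ResolutionOfSingularities.Theorems.SwitchingDichotomy.LowTaming

end
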